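import Mathlib.Analysis.MeanInequalities
import Literature.Analysis.FluidPDE.ScalarFourierData
import Literature.Analysis.FluidPDE.ScalarFourierSynthesis
import Literature.Analysis.FunctionSpaces.TorusFourierCalculus
import Literature.Analysis.FunctionSpaces.TorusLerayHelmholtzProofs
import Literature.Analysis.FunctionSpaces.TorusSobolevNormFacts
import HarnessLib
import Summits.AnomalousDissipation.AnomalousDissipation.Theses.SawtoothPulseCascade

/-!
# K1loc, line `Spectral` / SeqCone — helper: SPECTRAL LEAKAGE UNDER MULTIPLICATION (card v2.1 (E1′))

Helper file of the first prover lane on the crux `K1LocalisedCascade` (stmt-AnomalousDissipation-19491), route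
`SawtoothPulseCascade`, registered line `Cruxes.K1LocalisedCascade.Spectral` (one open stub `stub_highModeConcentration`).
The idea card `sequential-cone-partial-mixing` v2.1 (E1′) reduces the per-half-pulse transport of spectral ENERGY to the
following elementary Fourier fact on `T^d = UnitAddTorus d`, recorded here in the tree's vocabulary (`mFourierCoeff`,
lattice convolution `ScalarFourier.lconv`, Parseval `Torus.hasSum_sq_mFourierCoeff_of_continuous`):

**Spectral leakage lemma.**  Let `F, Θ : T^d → ℂ` be continuous with absolutely summable Fourier coefficients and
`‖Θ x‖ ≤ 1` for all `x`.  For ANY two sets of modes `A, N ⊆ ℤ^d` (target set and "near" set),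

  `√(∑_{k ∈ A} ‖𝓕(Θ F)(k)‖²) ≤ √(∑_{k ∈ A − N} ‖𝓕F(k)‖²) + (∑_{k ∉ N} ‖𝓕Θ(k)‖) · √(∫ ‖F‖²)`,

where `A − N = {a − n : a ∈ A, n ∈ N}` (pointwise difference of sets).  In words: multiplication by a multiplier of modulus
`≤ 1` moves spectral energy INTO `A` only from the modes `A − supp𝓕Θ`, up to a leakage controlled by the `ℓ¹` TAIL of
`𝓕Θ` off the chosen near set `N` (Young / `L^∞ × L² → L²`; no smallness of `‖𝓕Θ‖_{ℓ¹}` itself is needed — that norm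
is large for the cascade's partition functions).  The EXACT AFFINE TRANSPORT of (E1′) is the case
`Θ = e_b · ψ` (`𝓕(e_b ψ)(k) = 𝓕ψ(k − b)`, near set `b + {|n| ≤ Δ}`); the ZONE remainder of (E2) is handled by the
caller with the trivial bound `∫ |ψ_Z f|² ≤ ‖f‖_∞² |Z|`.

Proof (all in this file): split `𝓕F = a + b` with `a = 1_{A−N} 𝓕F`, and `𝓕Θ = p + q` with `p = 1_N 𝓕Θ`; synthesise
`F_a, F_b, Θ_p, Θ_q` (absolutely convergent series, `Torus.mFourierCoeff_tsum_mFourier_smul`); then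
`Θ F = Θ F_a + Θ_p F_b + Θ_q F_b`, the middle term has NO coefficient in `A` (`𝓕(Θ_p F_b)(k) = ∑_{m ∈ N} 𝓕Θ(m) b(k−m)`
and `k − m ∈ A − N` kills `b`), `‖Θ F_a‖_{L²} ≤ ‖F_a‖_{L²} = ‖a‖_{ℓ²}`, `‖Θ_q F_b‖_{L²} ≤ (∑_{k∉N}‖𝓕Θ k‖) ‖b‖_{ℓ²}`,
Parseval and Minkowski in `ℓ²`.

WHAT THIS IS NOT: no statement about the cascade or the stub itself; this is the line-independent Fourier tool the
per-half-pulse Egorov step (E1′) is assembled from (fibre by fibre, with the partition functions `Θ` of the flat strips).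
[cite: Grafakos2014, Prop. 3.1.2 (5) (coefficients of products/translates) and Prop. 3.2.7 (3) (Parseval)] [problem: turb]
-/

-- `Summit.<Summit>.<Problem>`: single-conjunct summit, the duplicate namespace segment is deliberate.
set_option linter.dupNamespace false

noncomputable section

namespace Summit.AnomalousDissipation.AnomalousDissipation.Theorems.SawtoothPulseCascade.SpectralLeakage

open MeasureTheory Set Filter Topology UnitAddTorus Complex
open scoped ENNReal NNReal Pointwise
open Literature.Analysis Literature.Analysis.FunctionSpaces Literature.Analysis.FluidPDE
open Literature.Analysis.FunctionSpaces.Torus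
open Literature.Analysis.FluidPDE.ScalarFourier (lconv lconv_apply)

variable {d : Type*} [Fintype d]

/-! ## §1 Synthesis of an absolutely summable coefficient family (bookkeeping) -/

/-- The synthesis `x ↦ ∑ₖ e_k(x) c_k` of an absolutely summable scalar family (a name-free abbreviation is avoided:
we work with `Torus.fourierSynth`). Its value is bounded by the `ℓ¹` norm of the coefficients. [folklore] -/
theorem norm_fourierSynth_le {c : (d → ℤ) → ℂ} (hc : Summable fun k => ‖c k‖) (x : UnitAddTorus d) :
    ‖fourierSynth c x‖ ≤ ∑' k, ‖c k‖ := by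
  unfold fourierSynth
  have h : ∀ k, ‖mFourier k x • c k‖ = ‖c k‖ := fun k => norm_mFourier_smul k x (c k)
  calc ‖∑' k, mFourier k x • c k‖ ≤ ∑' k, ‖mFourier k x • c k‖ := norm_tsum_le_tsum_norm (hc.congr fun k => (h k).symm)
    _ = ∑' k, ‖c k‖ := by simp_rw [h]

/-- The synthesis of an absolutely summable family is continuous. [folklore] -/
theorem continuous_fourierSynth {c : (d → ℤ) → ℂ} (hc : Summable fun k => ‖c k‖) :
    Continuous (fourierSynth c) :=
  continuous_tsum_mFourier_smul hc

/-- The Fourier coefficients of the synthesis are the given (absolutely summable) coefficients. [folklore] -/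
theorem mFourierCoeff_fourierSynth {c : (d → ℤ) → ℂ} (hc : Summable fun k => ‖c k‖) (k : d → ℤ) :
    mFourierCoeff (fourierSynth c) k = c k :=
  mFourierCoeff_tsum_mFourier_smul hc k

/-- The coefficients of the synthesis are absolutely summable (they are the given ones). [folklore] -/
theorem summable_norm_mFourierCoeff_fourierSynth {c : (d → ℤ) → ℂ} (hc : Summable fun k => ‖c k‖) :
    Summable fun k => ‖mFourierCoeff (fourierSynth c) k‖ := by
  simp_rw [mFourierCoeff_fourierSynth hc]; exact hc

/-- A continuous function with absolutely summable coefficients IS the synthesis of its coefficients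
(pointwise Fourier inversion, `ScalarFourier.tsum_mFourierCoeff_mul_mFourier`). [folklore] -/
theorem fourierSynth_mFourierCoeff_eq {F : UnitAddTorus d → ℂ} (hF : Continuous F)
    (hFs : Summable fun k => ‖mFourierCoeff F k‖) : fourierSynth (mFourierCoeff F) = F := by
  funext x
  unfold fourierSynth
  rw [← ScalarFourier.tsum_mFourierCoeff_mul_mFourier hF hFs x]
  refine tsum_congr fun k => ?_
  rw [smul_eq_mul, mul_comm]

omit [Fintype d] in
/-- Indicator truncations of an absolutely summable family are absolutely summable. [folklore] -/
theorem summable_norm_indicator {c : (d → ℤ) → ℂ} (hc : Summable fun k => ‖c k‖) (S : Set (d → ℤ)) :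
    Summable fun k => ‖S.indicator c k‖ :=
  hc.of_nonneg_of_le (fun _ => norm_nonneg _) fun k => by
    rw [norm_indicator_eq_indicator_norm]; exact Set.indicator_le_self' (fun _ _ => norm_nonneg _) k

/-- Splitting a synthesis along a set of modes: `F_c = F_{1_S c} + F_{1_{Sᶜ} c}`. [folklore] -/
theorem fourierSynth_indicator_add_compl {c : (d → ℤ) → ℂ} (hc : Summable fun k => ‖c k‖) (S : Set (d → ℤ))
    (x : UnitAddTorus d) :
    fourierSynth (S.indicator c) x + fourierSynth (Sᶜ.indicator c) x = fourierSynth c x := by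
  have h := (hasSum_mFourier_smul (summable_norm_indicator hc S) x).add
    (hasSum_mFourier_smul (summable_norm_indicator hc Sᶜ) x)
  have h' : HasSum (fun k => mFourier k x • c k)
      ((∑' k, mFourier k x • S.indicator c k) + ∑' k, mFourier k x • Sᶜ.indicator c k) := by
    refine h.congr_fun fun k => ?_
    rw [← smul_add, Set.indicator_self_add_compl_apply]
  exact (h'.tsum_eq).symm

/-! ## §2 Two elementary `L²` facts -/

/-- `∫ ‖Θ G‖² ≤ M² ∫ ‖G‖²` for continuous `Θ, G` with `‖Θ‖ ≤ M`. [folklore] -/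
theorem integral_norm_sq_mul_le {Θ G : UnitAddTorus d → ℂ} (hG : Continuous G) {M : ℝ}
    (hΘM : ∀ x, ‖Θ x‖ ≤ M) :
    ∫ x, ‖Θ x * G x‖ ^ 2 ≤ M ^ 2 * ∫ x, ‖G x‖ ^ 2 := by
  rw [← integral_const_mul]
  refine integral_mono_of_nonneg (ae_of_all _ fun x => by positivity)
    (((hG.norm.pow 2).const_smul (M ^ 2)).integrable_unitAddTorus.congr (ae_of_all _ fun x => by simp))
    (ae_of_all _ fun x => ?_)
  simp only [norm_mul, mul_pow]
  exact mul_le_mul_of_nonneg_right (pow_le_pow_left₀ (norm_nonneg _) (hΘM x) 2) (by positivity)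

omit [Fintype d] in
/-- Termwise comparison of indicator-truncated square families. [folklore] -/
theorem indicator_norm_sq_le {c : (d → ℤ) → ℂ} (S : Set (d → ℤ)) (k : d → ℤ) :
    ‖S.indicator c k‖ ^ 2 ≤ ‖c k‖ ^ 2 := by
  rw [norm_indicator_eq_indicator_norm]
  exact pow_le_pow_left₀ (Set.indicator_nonneg (fun _ _ => norm_nonneg _) k)
    (Set.indicator_le_self' (fun _ _ => norm_nonneg _) k) 2

omit [Fintype d] in
/-- `‖1_S c k‖² = 1_S (‖c ·‖²) k`. [folklore] -/
theorem norm_indicator_sq_eq {c : (d → ℤ) → ℂ} (S : Set (d → ℤ)) (k : d → ℤ) :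
    ‖S.indicator c k‖ ^ 2 = S.indicator (fun k => ‖c k‖ ^ 2) k := by
  by_cases hk : k ∈ S
  · rw [Set.indicator_of_mem hk, Set.indicator_of_mem hk]
  · rw [Set.indicator_of_notMem hk, Set.indicator_of_notMem hk, norm_zero, zero_pow two_ne_zero]

omit [Fintype d] in
/-- Minkowski in `ℓ²(ℤ^d)` for two square-summable nonnegative families, `√`-form. [folklore] -/
theorem sqrt_tsum_add_sq_le {u v : (d → ℤ) → ℝ} (hu0 : ∀ k, 0 ≤ u k) (hv0 : ∀ k, 0 ≤ v k)
    (hu : Summable fun k => u k ^ 2) (hv : Summable fun k => v k ^ 2) :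
    (Summable fun k => (u k + v k) ^ 2) ∧
      Real.sqrt (∑' k, (u k + v k) ^ 2) ≤ Real.sqrt (∑' k, u k ^ 2) + Real.sqrt (∑' k, v k ^ 2) := by
  have hu' : Summable fun k => u k ^ (2 : ℝ) := by simpa [Real.rpow_two] using hu
  have hv' : Summable fun k => v k ^ (2 : ℝ) := by simpa [Real.rpow_two] using hv
  have h := Real.Lp_add_le_tsum_of_nonneg (p := 2) (by norm_num) hu0 hv0 hu' hv'
  simp only [Real.rpow_two] at h
  refine ⟨h.1, ?_⟩
  simpa [Real.sqrt_eq_rpow] using h.2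

/-! ## §3 The spectral leakage lemma -/

/-- **Spectral leakage under multiplication** (card `sequential-cone-partial-mixing` v2.1 (E1′), abstract form).
Let `F, Θ : T^d → ℂ` be continuous with absolutely summable Fourier coefficients and `‖Θ x‖ ≤ 1`.  For any target
set of modes `A` and any "near" set `N`,
`√(∑_{k∈A} ‖𝓕(ΘF)(k)‖²) ≤ √(∑_{k∈A−N} ‖𝓕F(k)‖²) + (∑_{k∉N} ‖𝓕Θ(k)‖) · √(∫‖F‖²)`:
the energy that the product `Θ F` carries in `A` comes from the modes `A − N` of `F`, up to the `ℓ¹` tail of `𝓕Θ`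
off `N` times the total `L²` norm of `F`.
[cite: Grafakos2014, Prop. 3.1.2 (5) (coefficients of products are lattice convolutions) and Prop. 3.2.7 (3) (Parseval)] -/
theorem sqrt_tsum_indicator_sq_mul_le {F Θ : UnitAddTorus d → ℂ} (hF : Continuous F)
    (hFs : Summable fun k => ‖mFourierCoeff F k‖) (hΘ : Continuous Θ)
    (hΘs : Summable fun k => ‖mFourierCoeff Θ k‖) (hΘ1 : ∀ x, ‖Θ x‖ ≤ 1) (A N : Set (d → ℤ)) :
    Real.sqrt (∑' k, A.indicator (fun k => ‖mFourierCoeff (fun x => Θ x * F x) k‖ ^ 2) k) ≤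
      Real.sqrt (∑' k, (A - N).indicator (fun k => ‖mFourierCoeff F k‖ ^ 2) k) +
        (∑' k, Nᶜ.indicator (fun k => ‖mFourierCoeff Θ k‖) k) * Real.sqrt (∫ x, ‖F x‖ ^ 2) := by
  classical
  -- the four truncated coefficient families
  set a : (d → ℤ) → ℂ := (A - N).indicator (mFourierCoeff F) with ha_def
  set b : (d → ℤ) → ℂ := (A - N)ᶜ.indicator (mFourierCoeff F) with hb_def
  set p : (d → ℤ) → ℂ := N.indicator (mFourierCoeff Θ) with hp_def
  set q : (d → ℤ) → ℂ := Nᶜ.indicator (mFourierCoeff Θ) with hq_def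
  have ha : Summable fun k => ‖a k‖ := summable_norm_indicator hFs _
  have hb : Summable fun k => ‖b k‖ := summable_norm_indicator hFs _
  have hp : Summable fun k => ‖p k‖ := summable_norm_indicator hΘs _
  have hq : Summable fun k => ‖q k‖ := summable_norm_indicator hΘs _
  -- their syntheses
  set Fa : UnitAddTorus d → ℂ := fourierSynth a with hFa_def
  set Fb : UnitAddTorus d → ℂ := fourierSynth b with hFb_def
  set Tp : UnitAddTorus d → ℂ := fourierSynth p with hTp_def
  set Tq : UnitAddTorus d → ℂ := fourierSynth q with hTq_def
  have hFa_c : Continuous Fa := continuous_fourierSynth ha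
  have hFb_c : Continuous Fb := continuous_fourierSynth hb
  have hTp_c : Continuous Tp := continuous_fourierSynth hp
  have hTq_c : Continuous Tq := continuous_fourierSynth hq
  have hF_split : ∀ x, Fa x + Fb x = F x := fun x => by
    rw [hFa_def, hFb_def, ha_def, hb_def, fourierSynth_indicator_add_compl hFs (A - N) x,
      fourierSynth_mFourierCoeff_eq hF hFs]
  have hΘ_split : ∀ x, Tp x + Tq x = Θ x := fun x => by
    rw [hTp_def, hTq_def, hp_def, hq_def, fourierSynth_indicator_add_compl hΘs N x,
      fourierSynth_mFourierCoeff_eq hΘ hΘs]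
  -- the `ℓ¹` tail `τ` and the sup bound on the far multiplier
  set τ : ℝ := ∑' k, Nᶜ.indicator (fun k => ‖mFourierCoeff Θ k‖) k with hτ_def
  have hτq : τ = ∑' k, ‖q k‖ := by
    rw [hτ_def]; refine tsum_congr fun k => ?_; rw [hq_def, norm_indicator_eq_indicator_norm]
  have hτ0 : 0 ≤ τ := by rw [hτq]; exact tsum_nonneg fun _ => norm_nonneg _
  have hTq_le : ∀ x, ‖Tq x‖ ≤ τ := fun x => by rw [hτq]; exact norm_fourierSynth_le hq x
  -- the three products
  set G₁ : UnitAddTorus d → ℂ := fun x => Θ x * Fa x with hG₁_def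
  set G₂ : UnitAddTorus d → ℂ := fun x => Tp x * Fb x with hG₂_def
  set G₃ : UnitAddTorus d → ℂ := fun x => Tq x * Fb x with hG₃_def
  have hG₁_c : Continuous G₁ := hΘ.mul hFa_c
  have hG₂_c : Continuous G₂ := hTp_c.mul hFb_c
  have hG₃_c : Continuous G₃ := hTq_c.mul hFb_c
  have hprod : (fun x => Θ x * F x) = G₁ + (G₂ + G₃) := by
    funext x
    simp only [Pi.add_apply, hG₁_def, hG₂_def, hG₃_def]
    rw [← hF_split x, ← add_mul, hΘ_split x]
    ring
  have hcoeff : ∀ k, mFourierCoeff (fun x => Θ x * F x) k =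
      mFourierCoeff G₁ k + (mFourierCoeff G₂ k + mFourierCoeff G₃ k) := fun k => by
    rw [hprod, mFourierCoeff_add hG₁_c.integrable_unitAddTorus
        (hG₂_c.add hG₃_c).integrable_unitAddTorus,
      mFourierCoeff_add hG₂_c.integrable_unitAddTorus hG₃_c.integrable_unitAddTorus]
  -- the middle product has no coefficient in `A`
  have hmid : ∀ k ∈ A, mFourierCoeff G₂ k = 0 := by
    intro k hk
    rw [hG₂_def, ScalarFourier.mFourierCoeff_mul hTp_c (summable_norm_mFourierCoeff_fourierSynth hp) hFb_c k,
      lconv_apply]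
    have hterm : ∀ m, mFourierCoeff Tp m * mFourierCoeff Fb (k - m) = 0 := fun m => by
      rw [hTp_def, hFb_def, mFourierCoeff_fourierSynth hp, mFourierCoeff_fourierSynth hb]
      by_cases hm : m ∈ N
      · have hkm : k - m ∈ A - N := Set.sub_mem_sub hk hm
        rw [hb_def, Set.indicator_of_notMem (Set.notMem_compl_iff.mpr hkm), mul_zero]
      · rw [hp_def, Set.indicator_of_notMem hm, zero_mul]
    simp_rw [hterm, tsum_zero]
  -- Parseval for the pieces
  have hP1 := hasSum_sq_mFourierCoeff_of_continuous hG₁_c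
  have hP3 := hasSum_sq_mFourierCoeff_of_continuous hG₃_c
  have hPa : HasSum (fun k => ‖a k‖ ^ 2) (∫ x, ‖Fa x‖ ^ 2) := by
    have h := hasSum_sq_mFourierCoeff_of_continuous hFa_c
    simp_rw [hFa_def, mFourierCoeff_fourierSynth ha] at h
    exact h
  have hPb : HasSum (fun k => ‖b k‖ ^ 2) (∫ x, ‖Fb x‖ ^ 2) := by
    have h := hasSum_sq_mFourierCoeff_of_continuous hFb_c
    simp_rw [hFb_def, mFourierCoeff_fourierSynth hb] at h
    exact h
  have hPF := hasSum_sq_mFourierCoeff_of_continuous hF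
  -- `L²` bounds of the two surviving products
  have hG₁_le : ∫ x, ‖G₁ x‖ ^ 2 ≤ ∫ x, ‖Fa x‖ ^ 2 := by
    have := integral_norm_sq_mul_le hFa_c hΘ1
    simpa [hG₁_def] using this
  have hG₃_le : ∫ x, ‖G₃ x‖ ^ 2 ≤ τ ^ 2 * ∫ x, ‖Fb x‖ ^ 2 := by
    have := integral_norm_sq_mul_le hFb_c hTq_le
    simpa [hG₃_def] using this
  have hb_le : ∫ x, ‖Fb x‖ ^ 2 ≤ ∫ x, ‖F x‖ ^ 2 := by
    rw [← hPb.tsum_eq, ← hPF.tsum_eq]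
    exact hPb.summable.tsum_le_tsum (fun k => by rw [hb_def]; exact indicator_norm_sq_le _ k) hPF.summable
  -- Minkowski
  obtain ⟨hsum13, hMink⟩ := sqrt_tsum_add_sq_le (fun k => norm_nonneg (mFourierCoeff G₁ k))
    (fun k => norm_nonneg (mFourierCoeff G₃ k)) hP1.summable hP3.summable
  -- termwise: on `A` the coefficient is `𝓕G₁ + 𝓕G₃`
  have hA : ∀ k, A.indicator (fun k => ‖mFourierCoeff (fun x => Θ x * F x) k‖ ^ 2) k ≤
      (‖mFourierCoeff G₁ k‖ + ‖mFourierCoeff G₃ k‖) ^ 2 := fun k => by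
    by_cases hk : k ∈ A
    · rw [Set.indicator_of_mem hk, hcoeff k, hmid k hk, zero_add]
      exact pow_le_pow_left₀ (norm_nonneg _) (norm_add_le _ _) 2
    · rw [Set.indicator_of_notMem hk]; positivity
  have hA0 : ∀ k, 0 ≤ A.indicator (fun k => ‖mFourierCoeff (fun x => Θ x * F x) k‖ ^ 2) k :=
    fun k => Set.indicator_nonneg (fun _ _ => by positivity) k
  have hAsum : Summable fun k => A.indicator (fun k => ‖mFourierCoeff (fun x => Θ x * F x) k‖ ^ 2) k :=
    hsum13.of_nonneg_of_le hA0 hA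
  -- assemble
  calc Real.sqrt (∑' k, A.indicator (fun k => ‖mFourierCoeff (fun x => Θ x * F x) k‖ ^ 2) k)
      ≤ Real.sqrt (∑' k, (‖mFourierCoeff G₁ k‖ + ‖mFourierCoeff G₃ k‖) ^ 2) :=
        Real.sqrt_le_sqrt (hAsum.tsum_le_tsum hA hsum13)
    _ ≤ Real.sqrt (∑' k, ‖mFourierCoeff G₁ k‖ ^ 2) + Real.sqrt (∑' k, ‖mFourierCoeff G₃ k‖ ^ 2) := hMink
    _ = Real.sqrt (∫ x, ‖G₁ x‖ ^ 2) + Real.sqrt (∫ x, ‖G₃ x‖ ^ 2) := by rw [hP1.tsum_eq, hP3.tsum_eq]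
    _ ≤ Real.sqrt (∫ x, ‖Fa x‖ ^ 2) + Real.sqrt (τ ^ 2 * ∫ x, ‖F x‖ ^ 2) := by
        exact add_le_add (Real.sqrt_le_sqrt hG₁_le)
          (Real.sqrt_le_sqrt (hG₃_le.trans (mul_le_mul_of_nonneg_left hb_le (sq_nonneg τ))))
    _ = Real.sqrt (∑' k, (A - N).indicator (fun k => ‖mFourierCoeff F k‖ ^ 2) k) +
          τ * Real.sqrt (∫ x, ‖F x‖ ^ 2) := by
        rw [Real.sqrt_mul' _ (integral_nonneg fun x => by positivity), Real.sqrt_sq hτ0, ← hPa.tsum_eq]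
        congr 2
        refine tsum_congr fun k => ?_
        rw [ha_def, norm_indicator_sq_eq]

/-! ## §4 The exact affine transport: multiplication by a character shifts the coefficients -/

/-- **Shift rule** `𝓕(e_b · ψ)(k) = 𝓕ψ(k − b)` (no integrability needed): the EXACT affine transport of (E1′) — on a
flat strip the pulled-back phase is a character `e_b` times the partition function `ψ`, so the near set of
`sqrt_tsum_indicator_sq_mul_le` for `Θ = e_b ψ` is `b + {near set of ψ}` and its `ℓ¹` tail is that of `𝓕ψ`.
[cite: Grafakos2014, Prop. 3.1.2 (5) (coefficients of a character multiple)] -/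
theorem mFourierCoeff_mFourier_mul (ψ : UnitAddTorus d → ℂ) (b k : d → ℤ) :
    mFourierCoeff (fun x => mFourier b x * ψ x) k = mFourierCoeff ψ (k - b) := by
  simp only [mFourierCoeff_eq_integral_volume, smul_eq_mul]
  congr 1
  funext x
  rw [← mul_assoc, ← mFourier_add]
  congr 2
  abel

omit [Fintype d] in
/-- Membership in a translated set of modes: `j + b ∈ b +ᵥ N ↔ j ∈ N`. [folklore] -/
theorem add_mem_vadd_set_iff (b j : d → ℤ) (N : Set (d → ℤ)) : j + b ∈ b +ᵥ N ↔ j ∈ N := by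
  rw [add_comm, ← vadd_eq_add]
  exact Set.vadd_mem_vadd_set_iff

/-- The `ℓ¹` tail of `𝓕(e_b ψ)` off the shifted near set `b +ᵥ N` is the `ℓ¹` tail of `𝓕ψ` off `N`. [folklore] -/
theorem tsum_indicator_compl_vadd_mFourier_mul (ψ : UnitAddTorus d → ℂ) (b : d → ℤ) (N : Set (d → ℤ)) :
    ∑' k, (b +ᵥ N)ᶜ.indicator (fun k => ‖mFourierCoeff (fun x => mFourier b x * ψ x) k‖) k =
      ∑' k, Nᶜ.indicator (fun k => ‖mFourierCoeff ψ k‖) k := by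
  rw [← (Equiv.addRight b).tsum_eq]
  refine tsum_congr fun j => ?_
  rw [Equiv.coe_addRight]
  by_cases hj : j ∈ N
  · rw [Set.indicator_of_notMem (Set.notMem_compl_iff.mpr hj),
      Set.indicator_of_notMem (Set.notMem_compl_iff.mpr ((add_mem_vadd_set_iff b j N).mpr hj))]
  · rw [Set.indicator_of_mem (show j ∈ Nᶜ from hj),
      Set.indicator_of_mem (show j + b ∈ (b +ᵥ N)ᶜ from fun h => hj ((add_mem_vadd_set_iff b j N).mp h)),
      mFourierCoeff_mFourier_mul, add_sub_cancel_right]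

omit [Fintype d] in
/-- The translated difference set: `A − (b +ᵥ N) = (−b) +ᵥ (A − N)`, so the source modes of the exact affine transport
`Θ = e_b ψ` are the `N`-neighbourhood of `A` translated by `−b`. [folklore] -/
theorem sub_vadd_set_eq (A N : Set (d → ℤ)) (b : d → ℤ) : A - (b +ᵥ N) = (-b) +ᵥ (A - N) := by
  ext k
  simp only [Set.mem_sub, Set.mem_vadd_set, vadd_eq_add]
  constructor
  · rintro ⟨a, ha, _, ⟨n, hn, rfl⟩, rfl⟩
    exact ⟨a - n, ⟨a, ha, n, hn, rfl⟩, by abel⟩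
  · rintro ⟨_, ⟨a, ha, n, hn, rfl⟩, rfl⟩
    exact ⟨a, ha, b + n, ⟨n, hn, rfl⟩, by abel⟩

end Summit.AnomalousDissipation.AnomalousDissipation.Theorems.SawtoothPulseCascade.SpectralLeakage
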